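import Mathlib
import HarnessLib

/-!
# Route RootDecompLitSlice — brick B1′ «TERMINAL LIMIT FIELD» of the aside D₁ `DarkBallSpreads`
  (stmt-NavierStokesRegularity-29566, the registered stub `stub_darkBallSpreads` of crux D `NoDarkBall`
  stmt-NavierStokesRegularity-29563), part 1/2: **space–time Hölder bounds give smooth terminal limits
  (generic real analysis)**

Brick B1 (census, `Theorems/RootDecompLitSliceDarkBallSpreadsRegularPointSmoothing.lean`,
`regularPoint_iteratedFDeriv_bounds`) produces, at every REGULAR point `x₀` of the terminal slice of a
Clay-class solution blowing up at `T`, a backward cylinder `Q_r(T, x₀) = (T − r², T) × B(x₀, r)` on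
which every spatial derivative `Dⁿu` is HÖLDER IN SPACE–TIME (sup metric), uniformly up to `T`. The
interface `H_B1B3B4` of the D₁ tail (critic decomp-ns-crit-1 g8, bus L1183/L1186) then wants the
terminal field `w = lim_{t → T⁻} u(t, ·)` on the regular set, `C²`, with `u(t, ·) → w` locally
uniformly (and first derivatives, so that `curl`/`div` pass to the limit). This part proves the
passage «uniform Cauchy in `t`, then climb the derivative tower» in full generality (no PDE):

* §1 (metric): a map `F : ℝ → X → G` into a complete space, Hölder on `(a, b) × B` for the product
  (sup) metric with exponent `α > 0`, has pointwise limits as `s → b⁻`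
  (`exists_tendsto_of_holderOnWith_prod`, Cauchy criterion), at the rate `dist (F s x) (lim) ≤ C (b − s)^α`
  (`dist_le_of_holderOnWith_prod_of_tendsto`), hence converges UNIFORMLY on `B`
  (`tendstoUniformlyOn_of_holderOnWith_prod`); the limit is Hölder with the same constants;
* §2 (calculus): if every spatial derivative `iteratedFDeriv ℝ n (V s)` is space–time Hölder on
  `(a, b) × U`, `U` open, and the slices are smooth at the points of `U`, then ANY pointwise limit `w`
  of `V s` on `U` is `C^∞` on `U` and `iteratedFDeriv ℝ n (V s) → iteratedFDeriv ℝ n w` uniformly on `U`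
  for every `n` (`contDiffOn_and_tendstoUniformlyOn_iteratedFDeriv_of_holder`); in particular
  `V s → w` and `fderiv (V s) → fderiv w` uniformly on `U`. The tower is climbed with
  `hasFDerivAt_of_tendstoUniformlyOnFilter` and `fderiv_iteratedFDeriv`; the iterated derivatives of
  `w` are identified by induction through `continuousMultilinearCurryLeftEquiv`.

Part 2 (`Theorems/RootDecompLitSliceDarkBallSpreadsTerminalField.lean`) patches the cylinders of brick
B1 into the global terminal field on `Σ_Tᶜ`. HONEST FRAMING: elementary real analysis; closes no item;
decorative for the summit per D-0179; nothing here bears on NS regularity (rung 0). Lands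
`--supports stmt-NavierStokesRegularity-29566 --as helper` (decomp-ns route-writer g16). [folklore]
-/
noncomputable section

open MeasureTheory Set Function Filter Topology Metric
open scoped ENNReal NNReal ContDiff

-- the summit and its single sub-problem share the name (CONVENTIONS §1), as in every Theorems file
set_option linter.dupNamespace false

namespace Summit.NavierStokesRegularity.NavierStokesRegularity.Theorems

/-! ## §1 Hölder in space–time ⟹ uniform terminal limits -/

section Metric

variable {X : Type*} [PseudoMetricSpace X] {G : Type*} [PseudoMetricSpace G]

/-- Two time slices of a space–time Hölder map at the same spatial point are `C |s − s'|^α`-close.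
[folklore] -/
theorem dist_slice_le_of_holderOnWith_prod {F : ℝ → X → G} {a b : ℝ} {B : Set X} {C α : ℝ≥0}
    (hF : HolderOnWith C α (fun w : ℝ × X => F w.1 w.2) (Ioo a b ×ˢ B)) {x : X} (hx : x ∈ B)
    {s s' : ℝ} (hs : s ∈ Ioo a b) (hs' : s' ∈ Ioo a b) :
    dist (F s x) (F s' x) ≤ C * dist s s' ^ (α : ℝ) :=
  hF.dist_le_of_le (mk_mem_prod hs hx) (mk_mem_prod hs' hx) (by rw [dist_prod_same_right])

/-- **Pointwise terminal limits exist.** A map Hölder on `(a, b) × B` (sup metric, exponent `α > 0`)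
into a complete space has, at every `x ∈ B`, a limit as `s → b⁻` (Cauchy criterion). [folklore] -/
theorem exists_tendsto_of_holderOnWith_prod [CompleteSpace G] {F : ℝ → X → G} {a b : ℝ} (hab : a < b)
    {B : Set X}
    {C α : ℝ≥0} (hα : 0 < α)
    (hF : HolderOnWith C α (fun w : ℝ × X => F w.1 w.2) (Ioo a b ×ˢ B)) {x : X} (hx : x ∈ B) :
    ∃ y, Tendsto (fun s => F s x) (𝓝[<] b) (𝓝 y) := by
  rw [← cauchy_map_iff_exists_tendsto, cauchy_map_iff',
    Metric.uniformity_basis_dist.tendsto_right_iff]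
  intro ε hε
  have h1 : ∀ᶠ p : ℝ × ℝ in (𝓝[<] b) ×ˢ (𝓝[<] b), p.1 ∈ Ioo a b ∧ p.2 ∈ Ioo a b :=
    (eventually_mem_set.2 (Ioo_mem_nhdsLT hab)).prod_mk (eventually_mem_set.2 (Ioo_mem_nhdsLT hab))
  have h2 : ∀ᶠ p : ℝ × ℝ in (𝓝[<] b) ×ˢ (𝓝[<] b), (C : ℝ) * dist p.1 p.2 ^ (α : ℝ) < ε := by
    have hcont : Continuous fun p : ℝ × ℝ => (C : ℝ) * dist p.1 p.2 ^ (α : ℝ) :=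
      continuous_const.mul (continuous_dist.rpow_const fun _ => Or.inr (by positivity))
    have h0 : (C : ℝ) * dist ((b, b) : ℝ × ℝ).1 ((b, b) : ℝ × ℝ).2 ^ (α : ℝ) < ε := by
      have hα' : (α : ℝ) ≠ 0 := by exact_mod_cast hα.ne'
      simp [Real.zero_rpow hα', hε]
    have hev : ∀ᶠ p : ℝ × ℝ in 𝓝 ((b, b) : ℝ × ℝ), (C : ℝ) * dist p.1 p.2 ^ (α : ℝ) < ε :=
      hcont.continuousAt.eventually_lt continuousAt_const h0
    have hle : (𝓝[<] b) ×ˢ (𝓝[<] b) ≤ 𝓝 ((b, b) : ℝ × ℝ) := by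
      rw [nhds_prod_eq]
      exact Filter.prod_mono nhdsWithin_le_nhds nhdsWithin_le_nhds
    exact hev.filter_mono hle
  filter_upwards [h1, h2] with p hp hlt
  exact (dist_slice_le_of_holderOnWith_prod hF hx hp.1 hp.2).trans_lt hlt

/-- **Rate.** If `F s x → y` as `s → b⁻` then `dist (F s x) y ≤ C (b − s)^α` for `s ∈ (a, b)`.
[folklore] -/
theorem dist_le_of_holderOnWith_prod_of_tendsto {F : ℝ → X → G} {a b : ℝ} {B : Set X}
    {C α : ℝ≥0} (hF : HolderOnWith C α (fun w : ℝ × X => F w.1 w.2) (Ioo a b ×ˢ B))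
    {x : X} (hx : x ∈ B) {y : G} (hy : Tendsto (fun s => F s x) (𝓝[<] b) (𝓝 y))
    {s : ℝ} (hs : s ∈ Ioo a b) :
    dist (F s x) y ≤ C * (b - s) ^ (α : ℝ) := by
  have hab : a < b := hs.1.trans hs.2
  have hlim : Tendsto (fun s' : ℝ => (C : ℝ) * dist s s' ^ (α : ℝ)) (𝓝[<] b)
      (𝓝 ((C : ℝ) * (b - s) ^ (α : ℝ))) := by
    have hcont : Continuous fun s' : ℝ => (C : ℝ) * dist s s' ^ (α : ℝ) :=
      continuous_const.mul
        ((continuous_const.dist continuous_id).rpow_const fun _ => Or.inr (by positivity))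
    have := (hcont.tendsto b).mono_left (nhdsWithin_le_nhds (s := Iio b))
    convert this using 2
    rw [Real.dist_eq, abs_of_nonpos (by linarith [hs.2]), neg_sub]
  refine le_of_tendsto_of_tendsto (tendsto_const_nhds.dist hy) hlim ?_
  filter_upwards [Ioo_mem_nhdsLT hab] with s' hs'
  exact dist_slice_le_of_holderOnWith_prod hF hx hs hs'

/-- **Uniform terminal convergence.** Under the space–time Hölder bound (exponent `α > 0`), pointwise
limits on `B` are attained UNIFORMLY on `B` as `s → b⁻`. [folklore] -/
theorem tendstoUniformlyOn_of_holderOnWith_prod {F : ℝ → X → G} {a b : ℝ} (hab : a < b)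
    {B : Set X} {C α : ℝ≥0} (hα : 0 < α)
    (hF : HolderOnWith C α (fun w : ℝ × X => F w.1 w.2) (Ioo a b ×ˢ B))
    {g : X → G} (hg : ∀ x ∈ B, Tendsto (fun s => F s x) (𝓝[<] b) (𝓝 (g x))) :
    TendstoUniformlyOn F g (𝓝[<] b) B := by
  rw [Metric.tendstoUniformlyOn_iff]
  intro ε hε
  have hrate : ∀ᶠ s in 𝓝[<] b, (C : ℝ) * (b - s) ^ (α : ℝ) < ε := by
    have hcont : Continuous fun s : ℝ => (C : ℝ) * (b - s) ^ (α : ℝ) :=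
      continuous_const.mul
        ((continuous_const.sub continuous_id).rpow_const fun _ => Or.inr (by positivity))
    have h0 : (C : ℝ) * (b - b) ^ (α : ℝ) < ε := by
      have hα' : (α : ℝ) ≠ 0 := by exact_mod_cast hα.ne'
      simp [Real.zero_rpow hα', hε]
    exact (hcont.continuousAt.eventually_lt continuousAt_const h0).filter_mono nhdsWithin_le_nhds
  filter_upwards [hrate, Ioo_mem_nhdsLT hab] with s h1 h2 x hx
  rw [dist_comm]
  exact (dist_le_of_holderOnWith_prod_of_tendsto hF hx (hg x hx) h2).trans_lt h1

/-- The limit of a space–time Hölder map is Hölder on `B` with the same constants. [folklore] -/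
theorem holderOnWith_of_holderOnWith_prod_of_tendsto {F : ℝ → X → G} {a b : ℝ} (hab : a < b)
    {B : Set X} {C α : ℝ≥0}
    (hF : HolderOnWith C α (fun w : ℝ × X => F w.1 w.2) (Ioo a b ×ˢ B))
    {g : X → G} (hg : ∀ x ∈ B, Tendsto (fun s => F s x) (𝓝[<] b) (𝓝 (g x))) :
    ∀ x ∈ B, ∀ x' ∈ B, dist (g x) (g x') ≤ C * dist x x' ^ (α : ℝ) := by
  intro x hx x' hx'
  refine le_of_tendsto_of_tendsto ((hg x hx).dist (hg x' hx')) tendsto_const_nhds ?_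
  filter_upwards [Ioo_mem_nhdsLT hab] with s hs
  exact hF.dist_le_of_le (mk_mem_prod hs hx) (mk_mem_prod hs hx') (by rw [dist_prod_same_left])

end Metric

/-! ## §2 The derivative tower: smoothness of the terminal limit -/

section Tower

variable {E : Type*} [NormedAddCommGroup E] [NormedSpace ℝ E]
  {G : Type*} [NormedAddCommGroup G] [NormedSpace ℝ G] [CompleteSpace G]

omit [CompleteSpace G] in
/-- `fderiv` is `iteratedFDeriv 1` read through the currying isometry. [folklore] -/
theorem fderiv_eq_curryFin1_iteratedFDeriv_one (f : E → G) (z : E) :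
    fderiv ℝ f z = continuousMultilinearCurryFin1 ℝ E G (iteratedFDeriv ℝ 1 f z) := by
  ext x
  rw [continuousMultilinearCurryFin1_apply, iteratedFDeriv_one_apply]
  rfl

/-- **Pointwise terminal limits of a family with Hölder `0`-th derivative exist** (the order-`0`
Hölder bound is stated, as brick B1 states it, for `iteratedFDeriv ℝ 0`). [folklore] -/
theorem exists_tendsto_of_holderOnWith_iteratedFDeriv_zero {V : ℝ → E → G} {a b : ℝ} (hab : a < b)
    {U : Set E} {C α : ℝ≥0} (hα : 0 < α)
    (hH : HolderOnWith C α (fun w : ℝ × E => iteratedFDeriv ℝ 0 (V w.1) w.2) (Ioo a b ×ˢ U))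
    {y : E} (hy : y ∈ U) :
    ∃ z, Tendsto (fun s => V s y) (𝓝[<] b) (𝓝 z) := by
  obtain ⟨L, hL⟩ := exists_tendsto_of_holderOnWith_prod
    (F := fun s y => iteratedFDeriv ℝ 0 (V s) y) hab hα hH hy
  refine ⟨continuousMultilinearCurryFin0 ℝ E G L,
    ((continuousMultilinearCurryFin0 ℝ E G).continuous.tendsto L).comp hL |>.congr fun s => ?_⟩
  simp only [Function.comp_apply]
  rfl

/-- **The derivative tower.** Let `U` be open, the slices `V s`, `s ∈ (a, b)`, smooth at the points
of `U`, every spatial derivative `iteratedFDeriv ℝ n (V s)` space–time Hölder on `(a, b) × U`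
(exponent `> 0`), and `w` a pointwise limit of `V s` on `U` as `s → b⁻`. Then `w` is `C^∞` on `U`
and, for every `n`, `iteratedFDeriv ℝ n (V s) → iteratedFDeriv ℝ n w` uniformly on `U`.
[folklore] -/
theorem contDiffOn_and_tendstoUniformlyOn_iteratedFDeriv_of_holder {V : ℝ → E → G} {a b : ℝ}
    (hab : a < b) {U : Set E} (hU : IsOpen U)
    (hS : ∀ s ∈ Ioo a b, ∀ y ∈ U, ContDiffAt ℝ ∞ (V s) y)
    (hH : ∀ n : ℕ, ∃ C α : ℝ≥0, 0 < α ∧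
      HolderOnWith C α (fun w : ℝ × E => iteratedFDeriv ℝ n (V w.1) w.2) (Ioo a b ×ˢ U))
    {w : E → G} (hw : ∀ y ∈ U, Tendsto (fun s => V s y) (𝓝[<] b) (𝓝 (w y))) :
    ContDiffOn ℝ ∞ w U ∧
      ∀ n : ℕ, TendstoUniformlyOn (fun s => iteratedFDeriv ℝ n (V s)) (iteratedFDeriv ℝ n w)
        (𝓝[<] b) U := by
  -- the candidate derivatives: pointwise limits of the derivatives of the slices
  set g : (n : ℕ) → E → E [×n]→L[ℝ] G :=
    fun n y => limUnder (𝓝[<] b) fun s => iteratedFDeriv ℝ n (V s) y with hg_def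
  have hG : ∀ n, ∀ y ∈ U, Tendsto (fun s => iteratedFDeriv ℝ n (V s) y) (𝓝[<] b) (𝓝 (g n y)) := by
    intro n y hy
    obtain ⟨C, α, hα, hF⟩ := hH n
    exact tendsto_nhds_limUnder
      (exists_tendsto_of_holderOnWith_prod (F := fun s y => iteratedFDeriv ℝ n (V s) y) hab hα hF hy)
  have hGU : ∀ n, TendstoUniformlyOn (fun s => iteratedFDeriv ℝ n (V s)) (g n) (𝓝[<] b) U := by
    intro n
    obtain ⟨C, α, hα, hF⟩ := hH n
    exact tendstoUniformlyOn_of_holderOnWith_prod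
      (F := fun s y => iteratedFDeriv ℝ n (V s) y) hab hα hF (hG n)
  -- each `g n` is differentiable on `U` with derivative read off `g (n+1)`
  have hD : ∀ n, ∀ y ∈ U, HasFDerivAt (g n)
      (continuousMultilinearCurryLeftEquiv ℝ (fun _ : Fin (n + 1) => E) G (g (n + 1) y)) y := by
    intro n y hy
    set Λ := continuousMultilinearCurryLeftEquiv ℝ (fun _ : Fin (n + 1) => E) G with hΛ
    have h1 : TendstoUniformlyOn (fun s => (Λ : _ → _) ∘ iteratedFDeriv ℝ (n + 1) (V s))
        ((Λ : _ → _) ∘ g (n + 1)) (𝓝[<] b) U :=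
      Λ.lipschitz.uniformContinuous.comp_tendstoUniformlyOn (hGU (n + 1))
    have h2 : TendstoUniformlyOn (fun s => fderiv ℝ (iteratedFDeriv ℝ n (V s)))
        ((Λ : _ → _) ∘ g (n + 1)) (𝓝[<] b) U := by
      refine h1.congr (Eventually.of_forall fun s => fun z _ => ?_)
      rw [fderiv_iteratedFDeriv]
    show HasFDerivAt (g n) ((fun z => Λ (g (n + 1) z)) y) y
    refine hasFDerivAt_of_tendstoUniformlyOnFilter (l := 𝓝[<] b)
      (f := fun s => iteratedFDeriv ℝ n (V s))
      (f' := fun s z => fderiv ℝ (iteratedFDeriv ℝ n (V s)) z)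
      (g' := fun z => Λ (g (n + 1) z)) ?_ ?_ ?_
    · exact (tendstoUniformlyOn_iff_tendstoUniformlyOnFilter.1 h2).mono_right
        (le_principal_iff.2 (hU.mem_nhds hy))
    · have hs : ∀ᶠ s in 𝓝[<] b, s ∈ Ioo a b := eventually_mem_set.2 (Ioo_mem_nhdsLT hab)
      have hz : ∀ᶠ z in 𝓝 y, z ∈ U := hU.mem_nhds hy
      filter_upwards [hs.prod_mk hz] with p hp
      exact ((hS p.1 hp.1 p.2 hp.2).differentiableAt_iteratedFDeriv (m := n)
        (by exact_mod_cast ENat.coe_lt_top n)).hasFDerivAt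
    · filter_upwards [hU.mem_nhds hy] with z hz using hG n z hz
  -- identification of the iterated derivatives of `w` on `U`
  have hI : ∀ n, EqOn (iteratedFDeriv ℝ n w) (g n) U := by
    intro n
    induction n with
    | zero =>
      intro y hy
      have h1 : Tendsto (fun s => iteratedFDeriv ℝ 0 (V s) y) (𝓝[<] b)
          (𝓝 ((continuousMultilinearCurryFin0 ℝ E G).symm (w y))) := by
        have := ((continuousMultilinearCurryFin0 ℝ E G).symm.continuous.tendsto (w y)).comp (hw y hy)
        refine this.congr fun s => ?_
        simp only [Function.comp_apply]
        rfl
      rw [iteratedFDeriv_zero_eq_comp, Function.comp_apply]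
      exact (tendsto_nhds_unique (hG 0 y hy) h1).symm
    | succ n ih =>
      intro y hy
      have hev : iteratedFDeriv ℝ n w =ᶠ[𝓝 y] g n :=
        Filter.eventuallyEq_of_mem (hU.mem_nhds hy) ih
      rw [iteratedFDeriv_succ_eq_comp_left, Function.comp_apply, hev.fderiv_eq, (hD n y hy).fderiv]
      exact (continuousMultilinearCurryLeftEquiv ℝ (fun _ : Fin (n + 1) => E) G).symm_apply_apply _
  have hdiffg : ∀ n, DifferentiableOn ℝ (g n) U :=
    fun n y hy => (hD n y hy).differentiableAt.differentiableWithinAt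
  refine ⟨?_, fun n => (hGU n).congr_right (hI n).symm⟩
  refine contDiffOn_of_differentiableOn fun m _ => ?_
  exact (hdiffg m).congr fun y hy => (iteratedFDerivWithin_of_isOpen m hU hy).trans (hI m hy)

/-- **Smoothness of the terminal limit** (first component of the tower). [folklore] -/
theorem contDiffOn_of_tendsto_of_holderOnWith_iteratedFDeriv {V : ℝ → E → G} {a b : ℝ}
    (hab : a < b) {U : Set E} (hU : IsOpen U)
    (hS : ∀ s ∈ Ioo a b, ∀ y ∈ U, ContDiffAt ℝ ∞ (V s) y)
    (hH : ∀ n : ℕ, ∃ C α : ℝ≥0, 0 < α ∧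
      HolderOnWith C α (fun w : ℝ × E => iteratedFDeriv ℝ n (V w.1) w.2) (Ioo a b ×ˢ U))
    {w : E → G} (hw : ∀ y ∈ U, Tendsto (fun s => V s y) (𝓝[<] b) (𝓝 (w y))) :
    ContDiffOn ℝ ∞ w U :=
  (contDiffOn_and_tendstoUniformlyOn_iteratedFDeriv_of_holder hab hU hS hH hw).1

/-- **Uniform convergence of all spatial derivatives to those of the terminal limit** (second
component of the tower). [folklore] -/
theorem tendstoUniformlyOn_iteratedFDeriv_of_tendsto_of_holderOnWith {V : ℝ → E → G} {a b : ℝ}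
    (hab : a < b) {U : Set E} (hU : IsOpen U)
    (hS : ∀ s ∈ Ioo a b, ∀ y ∈ U, ContDiffAt ℝ ∞ (V s) y)
    (hH : ∀ n : ℕ, ∃ C α : ℝ≥0, 0 < α ∧
      HolderOnWith C α (fun w : ℝ × E => iteratedFDeriv ℝ n (V w.1) w.2) (Ioo a b ×ˢ U))
    {w : E → G} (hw : ∀ y ∈ U, Tendsto (fun s => V s y) (𝓝[<] b) (𝓝 (w y))) (n : ℕ) :
    TendstoUniformlyOn (fun s => iteratedFDeriv ℝ n (V s)) (iteratedFDeriv ℝ n w) (𝓝[<] b) U :=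
  (contDiffOn_and_tendstoUniformlyOn_iteratedFDeriv_of_holder hab hU hS hH hw).2 n

/-- **Uniform convergence of the slices themselves** (order `0`, uncurried). [folklore] -/
theorem tendstoUniformlyOn_of_tendsto_of_holderOnWith_iteratedFDeriv {V : ℝ → E → G} {a b : ℝ}
    (hab : a < b) {U : Set E} (hU : IsOpen U)
    (hS : ∀ s ∈ Ioo a b, ∀ y ∈ U, ContDiffAt ℝ ∞ (V s) y)
    (hH : ∀ n : ℕ, ∃ C α : ℝ≥0, 0 < α ∧
      HolderOnWith C α (fun w : ℝ × E => iteratedFDeriv ℝ n (V w.1) w.2) (Ioo a b ×ˢ U))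
    {w : E → G} (hw : ∀ y ∈ U, Tendsto (fun s => V s y) (𝓝[<] b) (𝓝 (w y))) :
    TendstoUniformlyOn V w (𝓝[<] b) U := by
  have h0 := tendstoUniformlyOn_iteratedFDeriv_of_tendsto_of_holderOnWith hab hU hS hH hw 0
  have h1 := (continuousMultilinearCurryFin0 ℝ E G).lipschitz.uniformContinuous.comp_tendstoUniformlyOn h0
  refine (h1.congr (Eventually.of_forall fun s => fun z _ => ?_)).congr_right fun z _ => ?_
  · simp only [Function.comp_apply]
    rfl
  · simp only [Function.comp_apply]
    rfl

/-- **Uniform convergence of the first derivatives** (order `1`, uncurried to `fderiv`). [folklore] -/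
theorem tendstoUniformlyOn_fderiv_of_tendsto_of_holderOnWith_iteratedFDeriv {V : ℝ → E → G}
    {a b : ℝ} (hab : a < b) {U : Set E} (hU : IsOpen U)
    (hS : ∀ s ∈ Ioo a b, ∀ y ∈ U, ContDiffAt ℝ ∞ (V s) y)
    (hH : ∀ n : ℕ, ∃ C α : ℝ≥0, 0 < α ∧
      HolderOnWith C α (fun w : ℝ × E => iteratedFDeriv ℝ n (V w.1) w.2) (Ioo a b ×ˢ U))
    {w : E → G} (hw : ∀ y ∈ U, Tendsto (fun s => V s y) (𝓝[<] b) (𝓝 (w y))) :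
    TendstoUniformlyOn (fun s => fderiv ℝ (V s)) (fderiv ℝ w) (𝓝[<] b) U := by
  have h0 := tendstoUniformlyOn_iteratedFDeriv_of_tendsto_of_holderOnWith hab hU hS hH hw 1
  have h1 := (continuousMultilinearCurryFin1 ℝ E G).lipschitz.uniformContinuous.comp_tendstoUniformlyOn h0
  refine (h1.congr (Eventually.of_forall fun s => fun z _ => ?_)).congr_right fun z _ => ?_
  · simp only [Function.comp_apply]
    rw [fderiv_eq_curryFin1_iteratedFDeriv_one]
  · simp only [Function.comp_apply]
    rw [fderiv_eq_curryFin1_iteratedFDeriv_one]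

end Tower

end Summit.NavierStokesRegularity.NavierStokesRegularity.Theorems
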